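import Summits.Ventures.PercRepro.C011

/-!
# PercRepro — the law form of a row kernel is its two-copy sum (typer-2, gen 5)

For any kernel `K` on the 15 rows, `Σ_{s,t} K(s,t) π_s π_t` (the LAW FORM at the law `π = law4`) equals the
two-copy sum `Σ_{ω,ω′} w(ω) w(ω′) K(row ω, row ω′)`; with `twoCopy_eq_sum_faces` (FaceGrouping) the law form
is therefore a nonnegative combination of the face (class) sums `Σ_ρ K(row(embed ρ), row(embed ρᶜ))` —
class-level positivity of `K` on every face implies the law-level inequality. This is the generic
engine behind `C011_of_LemmaBPlus`, stated once for every kernel (`lawForm_nonneg_of_faces`; the four-sum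
commutation is `LemmaBAbstract.sum_comm4`).
-/

namespace PercRepro

open Finset

namespace MultiGraph

variable {V E : Type*} (G : MultiGraph V E) [Fintype E] [DecidableEq E]

/-- **The law form of a kernel is its two-copy sum.** -/
theorem lawForm_eq_twoCopy (K : Fin 15 → Fin 15 → ℝ) (p : E → ℝ) (a b c d : V) :
    ∑ s : Fin 15, ∑ t : Fin 15, K s t * (G.law4 p a b c d s * G.law4 p a b c d t) =
      ∑ ω : Config E, ∑ ω' : Config E, weight p ω * weight p ω' *
        K (row4 (G.markedPartition ω ![a, b, c, d])) (row4 (G.markedPartition ω' ![a, b, c, d])) := by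
  simp only [law4_mul_law4, Finset.mul_sum]
  rw [sum_comm4]
  refine Finset.sum_congr rfl fun ω _ => Finset.sum_congr rfl fun ω' _ => ?_
  have hsplit : ∀ s t : Fin 15,
      (if row4 (G.markedPartition ω ![a, b, c, d]) = s ∧
          row4 (G.markedPartition ω' ![a, b, c, d]) = t then (1 : ℝ) else 0) =
        (if row4 (G.markedPartition ω ![a, b, c, d]) = s then (1 : ℝ) else 0) *
          (if row4 (G.markedPartition ω' ![a, b, c, d]) = t then (1 : ℝ) else 0) := by
    intro s t
    by_cases h1 : row4 (G.markedPartition ω ![a, b, c, d]) = s <;>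
      by_cases h2 : row4 (G.markedPartition ω' ![a, b, c, d]) = t <;> simp [h1, h2]
  simp only [hsplit, mul_ite, mul_one, mul_zero, Finset.sum_ite_eq, Finset.mem_univ, if_true]
  ring

/-- **Class-level positivity of a kernel on every face gives its law form** (the generic form of
`C011_of_LemmaBPlus`): if `Σ_ρ K(row(embed ρ), row(embed ρᶜ)) ≥ 0` on every face `[v, u]`, then
`Σ_{s,t} K(s,t) π_s π_t ≥ 0` at every `p ∈ [0,1]^E`. -/
theorem lawForm_nonneg_of_faces (K : Fin 15 → Fin 15 → ℝ) {p : E → ℝ} (hp : IsProb p) (a b c d : V)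
    (h : ∀ u v : Config E, v ≤ u → 0 ≤ ∑ ρ : Config (Face u v),
      K (row4 (G.markedPartition (embed u v ρ) ![a, b, c, d]))
        (row4 (G.markedPartition (embed u v ρᶜ) ![a, b, c, d]))) :
    0 ≤ ∑ s : Fin 15, ∑ t : Fin 15, K s t * (G.law4 p a b c d s * G.law4 p a b c d t) := by
  rw [G.lawForm_eq_twoCopy K p a b c d,
    twoCopy_eq_sum_faces p (fun ω => row4 (G.markedPartition ω ![a, b, c, d])) K]
  refine Finset.sum_nonneg fun uv _ => ?_
  refine mul_nonneg (mul_nonneg (weight_nonneg hp _) (weight_nonneg hp _)) ?_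
  split_ifs with hle
  · exact h uv.1 uv.2 hle
  · exact le_rfl

end MultiGraph

end PercRepro
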